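import Mathlib
import Literature.AlgebraicGeometry.Resolution.CobordantTupleGame
import Literature.AlgebraicGeometry.Resolution.CobordantChartCoefficients
import Literature.AlgebraicGeometry.Resolution.CobordantChartPlaneSlice
import Literature.AlgebraicGeometry.Resolution.PlaneGermBlowup
import Literature.AlgebraicGeometry.Resolution.PlaneGermBlowupCalculus
import Literature.AlgebraicGeometry.Resolution.FormalCoordinateChange
import Literature.AlgebraicGeometry.Resolution.NodalFamilyRingDomain
import Summits.ResolutionOfSingularities.ResolutionOfSingularities.Theorems.WeightedInvariantGlobalizeLocalDropCanonize
import Summits.ResolutionOfSingularities.ResolutionOfSingularities.Theorems.WeightedInvariantGlobalizeLocalDropCylinder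
import Summits.ResolutionOfSingularities.ResolutionOfSingularities.Theorems.WeightedInvariantLocalWeightedDropPlaneBranchDropOfCount

/-!
# Helpers for the monomial phase of the plane tuple game — unit monomials under charts and slices

Crux `LocalWeightedDrop` (stmt-ResolutionOfSingularities-8899, route ResolutionOfSingularities/WeightedInvariant),
line `hasse-ridge-face-selection`, registered stub `stub_planeMonomialPhase` (file
`WeightedInvariantLocalWeightedDropPlaneMonomialPhase`).  Notation: `x = X 0`, `y = X 1` in `k[[x, y]]`; after the
cobordant chart `CobordantChart.chart w c` (`x_i ↦ s^{w_i}(c_i + y_i')`) the variables are `s = X 0`,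
`y₀' = X (Fin.succ 0)`, `y₁' = X (Fin.succ 1)`; `TupleGame.slice i` kills `y_i'` and renames the other one to `X 1`.
A UNIT MONOMIAL is `u · x^α · y^β` with `u(0) ≠ 0`.

* `isNC_prodSupport`: a tuple of unit monomials (and zeros) has a normal-crossing support product;
* `exists_presentation`: if `TupleGame.prodSupport a` is a normal crossing, ONE legal `Φ` presents every non-zero
  entry as a unit monomial (divisors of `u xᵃ yᶜ`, `PlaneGerm.exists_eq_of_dvd_normalCrossing`);
* `marking_le_add`, `not_bad_of_lt`: badness read on exponents (`ord (u x^α y^β) = α + β`, and a constant-free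
  substitution does not lower orders);
* `subst_chart_unitMonomial`, `not_X_dvd_bracket`, `factor_eq` (registered sub-goal `stub_planeMonomialPhaseChart`):
  `(u x^α y^β)(chart) = s^{w₀α + w₁β} · [U (c₀ + y₀')^α (c₁ + y₁')^β]`, `s ∤ [...]`, so these ARE the factorisation
  data `(D_j, G_j)` of `TupleGame.StepDrop`;
* `newTuple_slot0`, `newTuple_slot1`: the successor tuple at a live slot is again a tuple of unit monomials,
  with exponents `(D_j - m_j W, β_j or 0)` resp. `(D_j - m_j W, α_j or 0)`;
* `one_le_floorWeight`, `marking_mul_scale`, `scale_pos`: arithmetic of the floor weight and of the normalisation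
  `L / m_j`, `L = (e + 2)!`.
-/

set_option linter.dupNamespace false -- mandated namespace of this single-conjunct summit

namespace Summit.ResolutionOfSingularities.ResolutionOfSingularities.Theorems

open Literature.AlgebraicGeometry.Resolution

namespace PlaneMonomialPhase

open MvPowerSeries

variable {k : Type} [Field k]

/-! ### Unit monomials and their products -/

/-- A unit monomial is non-zero. -/
theorem unitMonomial_ne_zero {u : MvPowerSeries (Fin 2) k} (hu : constantCoeff u ≠ 0) (p q : ℕ) :
    u * X 0 ^ p * X 1 ^ q ≠ 0 := by
  refine mul_ne_zero (mul_ne_zero ?_ (pow_ne_zero _ (FormalCoordChange.X_ne_zero' _)))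
    (pow_ne_zero _ (FormalCoordChange.X_ne_zero' _))
  rintro rfl
  exact hu (map_zero _)

/-- Products of unit monomials are unit monomials. -/
theorem unitMonomial_mul {f g : MvPowerSeries (Fin 2) k}
    (hf : ∃ (u : MvPowerSeries (Fin 2) k) (p q : ℕ), constantCoeff u ≠ 0 ∧ f = u * X 0 ^ p * X 1 ^ q)
    (hg : ∃ (u : MvPowerSeries (Fin 2) k) (p q : ℕ), constantCoeff u ≠ 0 ∧ g = u * X 0 ^ p * X 1 ^ q) :
    ∃ (u : MvPowerSeries (Fin 2) k) (p q : ℕ), constantCoeff u ≠ 0 ∧ f * g = u * X 0 ^ p * X 1 ^ q := by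
  obtain ⟨u, p, q, hu, rfl⟩ := hf
  obtain ⟨v, p', q', hv, rfl⟩ := hg
  refine ⟨u * v, p + p', q + q', ?_, by ring⟩
  rw [map_mul]
  exact mul_ne_zero hu hv

/-- A finite product of unit monomials is a unit monomial. -/
theorem unitMonomial_prod {ι : Type} (s : Finset ι) (f : ι → MvPowerSeries (Fin 2) k)
    (h : ∀ i ∈ s, ∃ (u : MvPowerSeries (Fin 2) k) (p q : ℕ), constantCoeff u ≠ 0 ∧ f i = u * X 0 ^ p * X 1 ^ q) :
    ∃ (u : MvPowerSeries (Fin 2) k) (p q : ℕ), constantCoeff u ≠ 0 ∧ (∏ i ∈ s, f i) = u * X 0 ^ p * X 1 ^ q :=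
  Finset.prod_induction f
    (fun g => ∃ (u : MvPowerSeries (Fin 2) k) (p q : ℕ), constantCoeff u ≠ 0 ∧ g = u * X 0 ^ p * X 1 ^ q)
    (fun _ _ hf hg => unitMonomial_mul hf hg) ⟨1, 0, 0, by simp, by simp⟩ h

/-- A unit monomial has normal-crossing support (identity coordinates). -/
theorem isNC_of_unitMonomial {g : MvPowerSeries (Fin 2) k}
    (hg : ∃ (u : MvPowerSeries (Fin 2) k) (p q : ℕ), constantCoeff u ≠ 0 ∧ g = u * X 0 ^ p * X 1 ^ q) :
    PlaneGerm.IsNC g := by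
  -- adapted from `ExceptionalSmoothCalculus.isNC_monomial`
  obtain ⟨u, p, q, hu, rfl⟩ := hg
  refine ⟨X, u, p, q, fun i => constantCoeff_X i, PlaneBranchDropOfCount.isUnit_det_X, hu, ?_⟩
  rw [subst_self]
  rfl

/-- The support product of a tuple of unit monomials (and zeros) has normal-crossing support. -/
theorem isNC_prodSupport {e : ℕ} (b : Fin (e + 1) → MvPowerSeries (Fin 2) k)
    (h : ∀ j, b j ≠ 0 → ∃ (u : MvPowerSeries (Fin 2) k) (p q : ℕ),
      constantCoeff u ≠ 0 ∧ b j = u * X 0 ^ p * X 1 ^ q) :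
    PlaneGerm.IsNC (TupleGame.prodSupport b) := by
  unfold TupleGame.prodSupport
  refine isNC_of_unitMonomial (unitMonomial_prod _ _ fun j _ => ?_)
  split_ifs with hj
  · exact ⟨1, 0, 0, by simp, by simp⟩
  · exact h j hj

/-! ### Presentations: one legal `Φ` making every non-zero entry a unit monomial -/

/-- PRESENTATIONS EXIST: if the support product of `a` is a normal crossing in the coordinates `Φ`, then every
non-zero entry `a_j ∘ Φ` is a unit monomial in the SAME coordinates (it divides `u xᵃ yᶜ`). -/
theorem exists_presentation {e : ℕ} (a : Fin (e + 1) → MvPowerSeries (Fin 2) k)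
    (h : PlaneGerm.IsNC (TupleGame.prodSupport a)) :
    ∃ Φ : Fin 2 → MvPowerSeries (Fin 2) k, (∀ i, constantCoeff (Φ i) = 0) ∧
      IsUnit (Matrix.det (Matrix.of fun i j => coeff (Finsupp.single j 1) (Φ i))) ∧
      ∀ j, ∃ α β : ℕ, a j ≠ 0 → ∃ u : MvPowerSeries (Fin 2) k, constantCoeff u ≠ 0 ∧
        subst Φ (a j) = u * X 0 ^ α * X 1 ^ β := by
  obtain ⟨Φ, u, p, q, hΦ0, hdet, hu, hsub⟩ := h
  refine ⟨Φ, hΦ0, hdet, fun j => ?_⟩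
  by_cases hj : a j = 0
  · exact ⟨0, 0, fun h => absurd hj h⟩
  · have hΦ : HasSubst Φ := hasSubst_of_constantCoeff_zero hΦ0
    have hdvd : subst Φ (a j) ∣ u * X 0 ^ p * X 1 ^ q := by
      rw [← hsub]
      unfold TupleGame.prodSupport
      rw [← coe_substAlgHom hΦ, map_prod]
      refine dvd_trans ?_ (Finset.dvd_prod_of_mem _ (Finset.mem_univ j))
      simp [hj]
    obtain ⟨u', α, β, hu', heq⟩ := PlaneGerm.exists_eq_of_dvd_normalCrossing hu hdvd
    exact ⟨α, β, fun _ => ⟨u', hu', heq⟩⟩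

/-! ### Badness read on exponents -/

/-- A constant-free substitution does not lower the order. -/
theorem order_le_order_subst {n : ℕ} {τ : Type} (Φ : Fin n → MvPowerSeries τ k)
    (hΦ0 : ∀ i, constantCoeff (Φ i) = 0) (f : MvPowerSeries (Fin n) k) : f.order ≤ (subst Φ f).order := by
  have h1 : (1 : ℕ∞) ≤ ⨅ i, (Φ i).order :=
    le_iInf fun i => one_le_order_iff_constCoeff_eq_zero.mpr (hΦ0 i)
  calc f.order = 1 * f.order := (one_mul _).symm
    _ ≤ (⨅ i, (Φ i).order) * f.order := mul_le_mul' h1 le_rfl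
    _ ≤ _ := le_order_subst (hasSubst_of_constantCoeff_zero hΦ0) f

/-- In a presentation of a BAD tuple the exponents satisfy `m_j ≤ α_j + β_j`. -/
theorem marking_le_add {e : ℕ} {a : Fin (e + 1) → MvPowerSeries (Fin 2) k} (hbad : TupleGame.Bad a)
    {Φ : Fin 2 → MvPowerSeries (Fin 2) k} (hΦ0 : ∀ i, constantCoeff (Φ i) = 0) {j : Fin (e + 1)}
    (hj : a j ≠ 0) {u : MvPowerSeries (Fin 2) k} (hu : constantCoeff u ≠ 0) {α β : ℕ}
    (h : subst Φ (a j) = u * X 0 ^ α * X 1 ^ β) : TupleGame.marking e j ≤ α + β := by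
  have h1 := (hbad j).resolve_left hj
  have h2 := order_le_order_subst Φ hΦ0 (a j)
  rw [h, PlaneBranchDropOfCount.order_unit_monomial hu] at h2
  exact_mod_cast h1.trans h2

/-- A tuple with a unit-monomial entry of total exponent `< m_j` is not bad. -/
theorem not_bad_of_lt {e : ℕ} {b : Fin (e + 1) → MvPowerSeries (Fin 2) k} {j : Fin (e + 1)}
    {u : MvPowerSeries (Fin 2) k} (hu : constantCoeff u ≠ 0) {p q : ℕ} (h : b j = u * X 0 ^ p * X 1 ^ q)
    (hlt : p + q < TupleGame.marking e j) : ¬ TupleGame.Bad b := by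
  intro hbad
  rcases hbad j with h0 | hle
  · exact unitMonomial_ne_zero hu p q (h ▸ h0)
  · rw [h, PlaneBranchDropOfCount.order_unit_monomial hu] at hle
    exact absurd hlt (not_lt.mpr (by exact_mod_cast hle))

/-! ### Unit monomials under the cobordant chart -/

/-- The chart substitution does not change constant coefficients. -/
theorem constantCoeff_subst_chart (w : Fin 2 → ℕ) (c : Fin 2 → k) (hc : ∀ i, w i = 0 → c i = 0)
    (u : MvPowerSeries (Fin 2) k) : constantCoeff (subst (CobordantChart.chart w c) u) = constantCoeff u :=
  constantCoeff_subst_of_constantCoeff_zero _ (CobordantArc.constantCoeff_chart w c hc) u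

/-- THE TRANSFORM OF A UNIT MONOMIAL: `(u x^α y^β)(chart) = s^{w₀ α + w₁ β} · [U (c₀ + y₀')^α (c₁ + y₁')^β]`. -/
theorem subst_chart_unitMonomial (w : Fin 2 → ℕ) (c : Fin 2 → k) (hc : ∀ i, w i = 0 → c i = 0)
    (u : MvPowerSeries (Fin 2) k) (α β : ℕ) :
    subst (CobordantChart.chart w c) (u * X 0 ^ α * X 1 ^ β) =
      X 0 ^ (w 0 * α + w 1 * β) * (subst (CobordantChart.chart w c) u *
        (C (c 0) + X (Fin.succ 0)) ^ α * (C (c 1) + X (Fin.succ 1)) ^ β) := by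
  have hchs := CobordantChart.hasSubst_chart w c hc
  rw [subst_mul hchs, subst_mul hchs, subst_pow hchs, subst_pow hchs, subst_X hchs, subst_X hchs,
    CobordantChart.chart_apply, CobordantChart.chart_apply, mul_pow, mul_pow, ← pow_mul, ← pow_mul]
  ring

/-- `s ∤ U · (c₀ + y₀')^α · (c₁ + y₁')^β` for a unit `U` (`s` is prime). -/
theorem not_X_dvd_bracket {U : MvPowerSeries (Fin 3) k} (hU : constantCoeff U ≠ 0) (c₀ c₁ : k) (α β : ℕ) :
    ¬ X 0 ∣ U * (C c₀ + X (Fin.succ 0)) ^ α * (C c₁ + X (Fin.succ 1)) ^ β := by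
  classical
  have hp : Prime (X (0 : Fin 3) : MvPowerSeries (Fin 3) k) := MvPowerSeries.prime_X' k 0
  have hlin : ∀ (r : k) (i : Fin 2), ¬ (X (0 : Fin 3) : MvPowerSeries (Fin 3) k) ∣ C r + X i.succ := by
    intro r i h
    rw [X_dvd_iff] at h
    have h0 : (Finsupp.single (i.succ : Fin 3) 1 : Fin 3 →₀ ℕ) 0 = 0 := by
      rw [Finsupp.single_apply, if_neg (Fin.succ_ne_zero i)]
    have h1 := h (Finsupp.single i.succ 1) h0
    rw [map_add, coeff_C, coeff_X, if_neg (Finsupp.single_ne_zero.mpr one_ne_zero), if_pos rfl,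
      zero_add] at h1
    exact one_ne_zero h1
  intro h
  rcases hp.dvd_or_dvd h with h1 | h2
  · rcases hp.dvd_or_dvd h1 with hU' | hα
    · rw [X_dvd_iff] at hU'
      have h0 := hU' 0 (Finsupp.zero_apply (a := (0 : Fin 3)))
      rw [coeff_zero_eq_constantCoeff_apply] at h0
      exact hU h0
    · exact hlin c₀ 0 (hp.dvd_of_dvd_pow hα)
  · exact hlin c₁ 1 (hp.dvd_of_dvd_pow h2)

/-- THE FACTORISATION DATA OF A UNIT MONOMIAL: if `(u x^α y^β)(chart) = s^D · G` with `s ∤ G` then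
`D = w₀ α + w₁ β` and `G = U (c₀ + y₀')^α (c₁ + y₁')^β`, `U = u(chart)`. -/
theorem factor_eq (w : Fin 2 → ℕ) (c : Fin 2 → k) (hc : ∀ i, w i = 0 → c i = 0)
    {u : MvPowerSeries (Fin 2) k} (hu : constantCoeff u ≠ 0) (α β : ℕ) {D : ℕ} {G : MvPowerSeries (Fin 3) k}
    (hfac : subst (CobordantChart.chart w c) (u * X 0 ^ α * X 1 ^ β) = X 0 ^ D * G) (hG : ¬ X 0 ∣ G) :
    D = w 0 * α + w 1 * β ∧ G = subst (CobordantChart.chart w c) u *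
      (C (c 0) + X (Fin.succ 0)) ^ α * (C (c 1) + X (Fin.succ 1)) ^ β := by
  rw [subst_chart_unitMonomial w c hc u α β] at hfac
  have hU : constantCoeff (subst (CobordantChart.chart w c) u) ≠ 0 := by
    rw [constantCoeff_subst_chart w c hc]
    exact hu
  obtain ⟨h1, h2⟩ := X_pow_mul_eq_X_pow_mul 0 hfac (not_X_dvd_bracket hU (c 0) (c 1) α β) hG
  exact ⟨h1.symm, h2.symm⟩

/-! ### Slices of the bracket -/

open scoped Classical in
/-- The slice at slot `0` (`c₀ ≠ 0`): `[sⁿ U (c₀ + y₀')^α (c₁ + y₁')^β]|_{y₀' = 0} = u' · sⁿ · y^{β or 0}`. -/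
theorem slice_zero_bracket (n : ℕ) {U : MvPowerSeries (Fin 3) k} (hU : constantCoeff U ≠ 0) (c : Fin 2 → k)
    (hc0 : c 0 ≠ 0) (α β : ℕ) :
    ∃ u' : MvPowerSeries (Fin 2) k, constantCoeff u' ≠ 0 ∧
      TupleGame.slice 0 (X 0 ^ n * (U * (C (c 0) + X (Fin.succ 0)) ^ α * (C (c 1) + X (Fin.succ 1)) ^ β)) =
        u' * X 0 ^ n * X 1 ^ (if c 1 = 0 then β else 0) := by
  have hsl := CobordantChartPlaneSlice.hasSubst_slice (R := k) (n := 2) 0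
  obtain ⟨V, hV, hVeq⟩ : ∃ V : MvPowerSeries (Fin 2) k, constantCoeff V ≠ 0 ∧ TupleGame.slice 0 U = V := by
    refine ⟨_, ?_, rfl⟩
    unfold TupleGame.slice
    rw [constantCoeff_subst_of_constantCoeff_zero _ (PlaneBranchDropOfCount.constantCoeff_slice 0)]
    exact hU
  unfold TupleGame.slice at hVeq ⊢
  rw [PlaneBranchDropOfCount.subst_slice_X_pow_mul, subst_mul hsl, subst_mul hsl, subst_pow hsl,
    subst_pow hsl, subst_add hsl, subst_add hsl, subst_C, subst_C,
    PlaneBranchDropOfCount.subst_slice_X_succ_self,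
    PlaneBranchDropOfCount.subst_slice_X_succ_of_ne (show (1 : Fin 2) ≠ 0 from one_ne_zero), add_zero, hVeq]
  by_cases hc1 : c 1 = 0
  · refine ⟨V * C (c 0) ^ α, ?_, ?_⟩
    · rw [map_mul, map_pow, constantCoeff_C]
      exact mul_ne_zero hV (pow_ne_zero _ hc0)
    · rw [if_pos hc1, hc1, map_zero, zero_add, ← map_pow]
      ring
  · refine ⟨V * C (c 0) ^ α * (C (c 1) + X 1) ^ β, ?_, ?_⟩
    · rw [map_mul, map_mul, map_pow, map_pow, map_add, constantCoeff_C, constantCoeff_C, constantCoeff_X,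
        add_zero]
      exact mul_ne_zero (mul_ne_zero hV (pow_ne_zero _ hc0)) (pow_ne_zero _ hc1)
    · rw [if_neg hc1, pow_zero, mul_one, ← map_pow]
      ring

open scoped Classical in
/-- The slice at slot `1` (`c₁ ≠ 0`): `[sⁿ U (c₀ + y₀')^α (c₁ + y₁')^β]|_{y₁' = 0} = u' · sⁿ · y^{α or 0}`. -/
theorem slice_one_bracket (n : ℕ) {U : MvPowerSeries (Fin 3) k} (hU : constantCoeff U ≠ 0) (c : Fin 2 → k)
    (hc1 : c 1 ≠ 0) (α β : ℕ) :
    ∃ u' : MvPowerSeries (Fin 2) k, constantCoeff u' ≠ 0 ∧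
      TupleGame.slice 1 (X 0 ^ n * (U * (C (c 0) + X (Fin.succ 0)) ^ α * (C (c 1) + X (Fin.succ 1)) ^ β)) =
        u' * X 0 ^ n * X 1 ^ (if c 0 = 0 then α else 0) := by
  have hsl := CobordantChartPlaneSlice.hasSubst_slice (R := k) (n := 2) 1
  obtain ⟨V, hV, hVeq⟩ : ∃ V : MvPowerSeries (Fin 2) k, constantCoeff V ≠ 0 ∧ TupleGame.slice 1 U = V := by
    refine ⟨_, ?_, rfl⟩
    unfold TupleGame.slice
    rw [constantCoeff_subst_of_constantCoeff_zero _ (PlaneBranchDropOfCount.constantCoeff_slice 1)]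
    exact hU
  unfold TupleGame.slice at hVeq ⊢
  rw [PlaneBranchDropOfCount.subst_slice_X_pow_mul, subst_mul hsl, subst_mul hsl, subst_pow hsl,
    subst_pow hsl, subst_add hsl, subst_add hsl, subst_C, subst_C,
    PlaneBranchDropOfCount.subst_slice_X_succ_self,
    PlaneBranchDropOfCount.subst_slice_X_succ_of_ne (show (0 : Fin 2) ≠ 1 from zero_ne_one), add_zero, hVeq]
  by_cases hc0 : c 0 = 0
  · refine ⟨V * C (c 1) ^ β, ?_, ?_⟩
    · rw [map_mul, map_pow, constantCoeff_C]
      exact mul_ne_zero hV (pow_ne_zero _ hc1)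
    · rw [if_pos hc0, hc0, map_zero, zero_add, ← map_pow]
      ring
  · refine ⟨V * C (c 1) ^ β * (C (c 0) + X 1) ^ α, ?_, ?_⟩
    · rw [map_mul, map_mul, map_pow, map_pow, map_add, constantCoeff_C, constantCoeff_C, constantCoeff_X,
        add_zero]
      exact mul_ne_zero (mul_ne_zero hV (pow_ne_zero _ hc1)) (pow_ne_zero _ hc0)
    · rw [if_neg hc0, pow_zero, mul_one, ← map_pow]
      ring

/-! ### The successor tuple at a live slot -/

/-- Zero entries stay zero. -/
theorem newTuple_of_eq_zero {m e : ℕ} {a : Fin (e + 1) → MvPowerSeries (Fin m) k} (D : Fin (e + 1) → ℕ)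
    (G : Fin (e + 1) → MvPowerSeries (Fin (m + 1)) k) (i : Fin m) {j : Fin (e + 1)} (hj : a j = 0) :
    TupleGame.newTuple a D G i j = 0 := by
  unfold TupleGame.newTuple
  rw [if_pos hj]

open scoped Classical in
/-- THE SUCCESSOR AT SLOT `0` of a presented tuple: the factorisation exponents are `D_j = w₀ α_j + w₁ β_j`, and
the new entries are unit monomials `u'_j · x^{D_j - m_j W} · y^{β_j}` (`c₁ = 0`) resp. `· y⁰` (`c₁ ≠ 0`). -/
theorem newTuple_slot0 {e : ℕ} {a : Fin (e + 1) → MvPowerSeries (Fin 2) k} {Φ : Fin 2 → MvPowerSeries (Fin 2) k}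
    {α β : Fin (e + 1) → ℕ}
    (hpres : ∀ j, a j ≠ 0 → ∃ u : MvPowerSeries (Fin 2) k, constantCoeff u ≠ 0 ∧
      subst Φ (a j) = u * X 0 ^ α j * X 1 ^ β j)
    (w : Fin 2 → ℕ) (c : Fin 2 → k) (hc : ∀ i, w i = 0 → c i = 0) (hc0 : c 0 ≠ 0)
    (D : Fin (e + 1) → ℕ) (G : Fin (e + 1) → MvPowerSeries (Fin 3) k)
    (hfac : ∀ j, a j ≠ 0 →
      subst (CobordantChart.chart w c) (subst Φ (a j)) = X 0 ^ D j * G j ∧ ¬ X 0 ∣ G j) :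
    (∀ j, a j ≠ 0 → D j = w 0 * α j + w 1 * β j) ∧
    ∀ j, a j ≠ 0 → ∃ u' : MvPowerSeries (Fin 2) k, constantCoeff u' ≠ 0 ∧
      TupleGame.newTuple a D G 0 j = u' * X 0 ^ (D j - TupleGame.marking e j * TupleGame.floorWeight a D) *
        X 1 ^ (if c 1 = 0 then β j else 0) := by
  have key : ∀ j, a j ≠ 0 → D j = w 0 * α j + w 1 * β j ∧ ∃ U : MvPowerSeries (Fin 3) k,
      constantCoeff U ≠ 0 ∧ G j = U * (C (c 0) + X (Fin.succ 0)) ^ α j * (C (c 1) + X (Fin.succ 1)) ^ β j := by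
    intro j hj
    obtain ⟨u, hu, hju⟩ := hpres j hj
    obtain ⟨h1, h2⟩ := hfac j hj
    rw [hju] at h1
    obtain ⟨hD, hG⟩ := factor_eq w c hc hu (α j) (β j) h1 h2
    exact ⟨hD, _, by rw [constantCoeff_subst_chart w c hc]; exact hu, hG⟩
  refine ⟨fun j hj => (key j hj).1, fun j hj => ?_⟩
  obtain ⟨-, U, hU, hG⟩ := key j hj
  obtain ⟨u', hu', hsl⟩ := slice_zero_bracket (D j - TupleGame.marking e j * TupleGame.floorWeight a D) hU c hc0
    (α j) (β j)
  refine ⟨u', hu', ?_⟩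
  unfold TupleGame.newTuple
  rw [if_neg hj, hG, hsl]

open scoped Classical in
/-- THE SUCCESSOR AT SLOT `1` of a presented tuple (symmetric to `newTuple_slot0`). -/
theorem newTuple_slot1 {e : ℕ} {a : Fin (e + 1) → MvPowerSeries (Fin 2) k} {Φ : Fin 2 → MvPowerSeries (Fin 2) k}
    {α β : Fin (e + 1) → ℕ}
    (hpres : ∀ j, a j ≠ 0 → ∃ u : MvPowerSeries (Fin 2) k, constantCoeff u ≠ 0 ∧
      subst Φ (a j) = u * X 0 ^ α j * X 1 ^ β j)
    (w : Fin 2 → ℕ) (c : Fin 2 → k) (hc : ∀ i, w i = 0 → c i = 0) (hc1 : c 1 ≠ 0)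
    (D : Fin (e + 1) → ℕ) (G : Fin (e + 1) → MvPowerSeries (Fin 3) k)
    (hfac : ∀ j, a j ≠ 0 →
      subst (CobordantChart.chart w c) (subst Φ (a j)) = X 0 ^ D j * G j ∧ ¬ X 0 ∣ G j) :
    (∀ j, a j ≠ 0 → D j = w 0 * α j + w 1 * β j) ∧
    ∀ j, a j ≠ 0 → ∃ u' : MvPowerSeries (Fin 2) k, constantCoeff u' ≠ 0 ∧
      TupleGame.newTuple a D G 1 j = u' * X 0 ^ (D j - TupleGame.marking e j * TupleGame.floorWeight a D) *
        X 1 ^ (if c 0 = 0 then α j else 0) := by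
  have key : ∀ j, a j ≠ 0 → D j = w 0 * α j + w 1 * β j ∧ ∃ U : MvPowerSeries (Fin 3) k,
      constantCoeff U ≠ 0 ∧ G j = U * (C (c 0) + X (Fin.succ 0)) ^ α j * (C (c 1) + X (Fin.succ 1)) ^ β j := by
    intro j hj
    obtain ⟨u, hu, hju⟩ := hpres j hj
    obtain ⟨h1, h2⟩ := hfac j hj
    rw [hju] at h1
    obtain ⟨hD, hG⟩ := factor_eq w c hc hu (α j) (β j) h1 h2
    exact ⟨hD, _, by rw [constantCoeff_subst_chart w c hc]; exact hu, hG⟩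
  refine ⟨fun j hj => (key j hj).1, fun j hj => ?_⟩
  obtain ⟨-, U, hU, hG⟩ := key j hj
  obtain ⟨u', hu', hsl⟩ := slice_one_bracket (D j - TupleGame.marking e j * TupleGame.floorWeight a D) hU c hc1
    (α j) (β j)
  refine ⟨u', hu', ?_⟩
  unfold TupleGame.newTuple
  rw [if_neg hj, hG, hsl]

/-! ### Arithmetic of the floor weight and of the normalisation `L / m_j`, `L = (e + 2)!` -/

/-- If every non-zero entry has `m_j ≤ D_j` then the floor weight is at least `1`. -/
theorem one_le_floorWeight {m e : ℕ} {a : Fin (e + 1) → MvPowerSeries (Fin m) k} (ha : a ≠ 0)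
    (D : Fin (e + 1) → ℕ) (h : ∀ j, a j ≠ 0 → TupleGame.marking e j ≤ D j) :
    1 ≤ TupleGame.floorWeight a D := by
  obtain ⟨j, hj, hlt⟩ := TupleGame.exists_lt_marking_mul_floorWeight_succ ha D
  by_contra h0
  have h0' : TupleGame.floorWeight a D = 0 := by omega
  rw [h0', zero_add, mul_one] at hlt
  exact absurd (h j hj) (not_le.mpr hlt)

/-- `m_j ∣ (e + 2)!`. -/
theorem marking_dvd_factorial (e : ℕ) (j : Fin (e + 1)) : TupleGame.marking e j ∣ (e + 2).factorial :=
  Nat.dvd_factorial (TupleGame.marking_pos e j) (by have := TupleGame.marking_add_val e j; omega)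

/-- `m_j · (L / m_j) = L`. -/
theorem marking_mul_scale (e : ℕ) (j : Fin (e + 1)) :
    TupleGame.marking e j * ((e + 2).factorial / TupleGame.marking e j) = (e + 2).factorial :=
  Nat.mul_div_cancel' (marking_dvd_factorial e j)

/-- `0 < L / m_j`. -/
theorem scale_pos (e : ℕ) (j : Fin (e + 1)) : 0 < (e + 2).factorial / TupleGame.marking e j :=
  Nat.div_pos (Nat.le_of_dvd (Nat.factorial_pos _) (marking_dvd_factorial e j)) (TupleGame.marking_pos e j)

end PlaneMonomialPhase

/-- Registered sub-goal `stub_planeMonomialPhaseChart` of `stub_planeMonomialPhase` (every field): THE FACTORISATION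
DATA OF A UNIT MONOMIAL UNDER A COBORDANT CHART.  For weights `w` and an exceptional point `c` (with `c_i = 0` where
`w_i = 0`), if `(u · x^α · y^β)(s^{w₀}(c₀ + y₀'), s^{w₁}(c₁ + y₁')) = s^D · G` with `u(0) ≠ 0` and `s ∤ G`, then
`D = w₀ α + w₁ β` and `G = u(chart) · (c₀ + y₀')^α · (c₁ + y₁')^β` (the chart is a ring map, `s` is prime, and the
`s`-adic factorisation is unique). -/
theorem stub_planeMonomialPhaseChart : ∀ (k : Type) [Field k] (w : Fin 2 → ℕ) (c : Fin 2 → k),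
    (∀ i, w i = 0 → c i = 0) → ∀ (u : MvPowerSeries (Fin 2) k) (α β D : ℕ) (G : MvPowerSeries (Fin 3) k),
    MvPowerSeries.constantCoeff u ≠ 0 →
    MvPowerSeries.subst (CobordantChart.chart w c) (u * MvPowerSeries.X 0 ^ α * MvPowerSeries.X 1 ^ β) =
      MvPowerSeries.X 0 ^ D * G → ¬ (MvPowerSeries.X (0 : Fin 3) ∣ G) →
    D = w 0 * α + w 1 * β ∧ G = MvPowerSeries.subst (CobordantChart.chart w c) u *
      (MvPowerSeries.C (c 0) + MvPowerSeries.X (Fin.succ 0)) ^ α *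
        (MvPowerSeries.C (c 1) + MvPowerSeries.X (Fin.succ 1)) ^ β := by
  intro k _ w c hc u α β D G hu hfac hG
  exact PlaneMonomialPhase.factor_eq w c hc hu α β hfac hG

end Summit.ResolutionOfSingularities.ResolutionOfSingularities.Theorems
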